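import Summits.CriticalPhenomena.PercolationContinuityZ3.Theorems.PercNearOneGluingNoHeavyLowerTailSahiE3ExchangeCross
import Mathlib.Combinatorics.SetFamily.FourFunctions
import Mathlib.Tactic.Linarith
import Mathlib.Tactic.Ring
import Mathlib.Tactic.Positivity
import HarnessLib
import HarnessLib.Audit

/-!
# `NoHeavyLowerTail` (crux stmt-CriticalPhenomena-4575), Sahi programme P4: the 2×2 exchange lemma in the PURE class — the crossing-product criterion, the full-slot case, and the first ORDER-structural cases (Ahlswede–Daykin)

Support file (cell `prim-l12`, seat P4, generation 28; `--supports stmt-CriticalPhenomena-4575`).  No named facts, no sorries;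
standard axioms; def-free.

Context (HOME prim-l12-p4/FROM-prim-l12-p4-gen28-*.md; predecessors `…SahiE3ExchangeCross` (crossing-free case),
`…SahiE3ExchangePure` (Lemma A, sign cases), `…SahiE3ExchangePureCut` (cut chain, low-crossing case), `…SahiE3ExchangeFlat`).
Harris block `(B, w, V)` (`w ≥ 0` of mass `1`, slot `V`, `v = w(V)`, `a(X) = w(X∩V)`, `c(X) = w(X∖V)`), PURE configuration
`K ⊇ L`, `L' ⊇ K'`, differences `A = K∖L`, `A' = L'∖K'`, crossing cell `Ξ = A∩A'∩V`, supplies `S₁ = KK'V`, `S₂ = LL'V`;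
`need(X,Y) = x·a(Y) + y·a(X) − v·x·y`.  With the same-footprint packing `R(S₁) ≥ need(K,K')`, `R(S₂) ≥ need(L,L')` the pure-class
exchange expression `Φ(R)` is bounded below by
  `same0 = Har(K;K'_V) + Har(L';L_V) + (1−v)·Har(K,L') + w(Ξ) + c(A)·c(A') − a(A)·a(A')`     (`same0_identity` is used inline),
so `Φ ≥ 0` as soon as the CROSSING-PRODUCT CRITERION `a(A)·a(A') ≤ w(Ξ)` holds (`exchange_pure_of_cross_product_le`).  Consequences:
* FULL-SLOT case `K ∪ L' ⊆ V` (`exchange_pure_of_subset_slot`): there `same0 = (2−v)·Har(K,L') + Har(L,K') ≥ 0` — no condition on `Ξ`.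
* On a finite DISTRIBUTIVE LATTICE with `w` log-supermodular (`w(x)w(y) ≤ w(x⊓y)w(x⊔y)`, the FKG hypothesis of the programme), the
  Ahlswede–Daykin four functions theorem (Mathlib `four_functions_theorem`) gives `w(X)·w(Y) ≤ w(J)` whenever every join `x ⊔ y`,
  `x ∈ X`, `y ∈ Y`, lies in `J` (`sum_mul_sum_le_of_sups_subset`); hence the JOIN case (`exchange_pure_of_joins`): if every join of a
  `V`-point of `K∖L` with a `V`-point of `L'∖K'` is a crossing point, then `Φ ≥ 0`; in particular the TOP-CROSSING case
  (`exchange_pure_of_topCross`): `K, L, K', L', V` up-closed and some `ξ ∉ L ∪ K'` lies above every `V`-point of `K∖L` and of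
  `L'∖K'` (e.g. a crossing point dominating both slot-traces).  These are the first cases of the exchange lemma proved from the ORDER
  structure of the block (generation 27 showed that the remaining cases admit no order-free certificate).
NOT claimed: the general single-crossing case (generation 28 conjecture XI1: `max(same0, cut_K, cut_L') ≥ 0` when `|Ξ| = 1`).
-/

namespace Summit.CriticalPhenomena.PercolationContinuityZ3.Theorems.SahiE3ExchangeJoin

open Finset SahiE3DimerPacking SahiE3ExchangeCross
open scoped BigOperators FinsetFamily

section Algebra

variable {B : Type*} [DecidableEq B]

omit [DecidableEq B] in
/-- A sum of a nonnegative weight is nonnegative. [folklore] -/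
private theorem sum_nonneg'' (w : B → ℝ) (hw : ∀ b, 0 ≤ w b) (X : Finset B) : 0 ≤ ∑ b ∈ X, w b :=
  Finset.sum_nonneg fun b _ => hw b

/-- For `Z ⊆ X`: `w((X∖Z)∩V) = w(X∩V) − w(Z∩V)`. [folklore] -/
theorem sum_sdiff_inter (w : B → ℝ) (V X Z : Finset B) (hZ : Z ⊆ X) :
    ∑ b ∈ (X \ Z) ∩ V, w b = ∑ b ∈ X ∩ V, w b - ∑ b ∈ Z ∩ V, w b := by
  have hset : (X \ Z) ∩ V = (X ∩ V) \ (Z ∩ V) := by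
    ext b; simp only [Finset.mem_inter, Finset.mem_sdiff]; tauto
  rw [hset]
  exact Finset.sum_sdiff_eq_sub (Finset.inter_subset_inter hZ le_rfl)

/-- The slot-trace of the crossing cell in the pure class: for `L ⊆ K`, `K' ⊆ L'`,
`w((K∖L)∩(L'∖K')∩V) = a(KL') − a(KK') − a(LL') + a(LK')`. [this work] -/
theorem sum_cross_cell (w : B → ℝ) (V K L K' L' : Finset B) (hLK : L ⊆ K) (hK'L' : K' ⊆ L') :
    ∑ b ∈ ((K \ L) ∩ (L' \ K')) ∩ V, w b
      = ∑ b ∈ (K ∩ L') ∩ V, w b - ∑ b ∈ (K ∩ K') ∩ V, w b - ∑ b ∈ (L ∩ L') ∩ V, w b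
        + ∑ b ∈ (L ∩ K') ∩ V, w b := by
  have h : ∑ b ∈ ((K \ L) ∩ (L' \ K')) ∩ V, w b + ∑ b ∈ (K ∩ K') ∩ V, w b + ∑ b ∈ (L ∩ L') ∩ V, w b
      = ∑ b ∈ (K ∩ L') ∩ V, w b + ∑ b ∈ (L ∩ K') ∩ V, w b := by
    simp only [sum_inter_eq_sum_ite, ← Finset.sum_add_distrib]
    refine Finset.sum_congr rfl fun b _ => ?_
    simp only [Finset.mem_inter, Finset.mem_sdiff]
    by_cases hk : b ∈ K <;> by_cases hl : b ∈ L <;> by_cases hk' : b ∈ K' <;> by_cases hl' : b ∈ L' <;>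
      simp [hk, hl, hk', hl'] <;> first | exact absurd (hLK hl) hk | exact absurd (hK'L' hk') hl'
  linarith

/-- **Crossing-product criterion (pure class).**  `B` finite, `w ≥ 0` of mass `1`, slot `V`, `L ⊆ K`, `K' ⊆ L'`; a weight `R`
satisfying the pair inequality at the same-index pairs `(K,K')`, `(L,L')`; the Harris products `Har(K;K'_V)`, `Har(L';L_V)`,
`Har(K,L') ≥ 0`; and the criterion `a(K∖L)·a(L'∖K') ≤ w((K∖L)∩(L'∖K')∩V)` (slot-masses of the two differences versus the slot-mass
of the crossing cell).  Then the pure-class exchange expression is `≥ 0`: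
`Φ ≥ same0 = Har(K;K'_V) + Har(L';L_V) + (1−v)Har(K,L') + [w(Ξ) − a(A)a(A')] + c(A)c(A') ≥ 0`. [this work] -/
theorem exchange_pure_of_cross_product_le [Fintype B] (w R : B → ℝ) (hw : ∀ b, 0 ≤ w b) (hw1 : ∑ b, w b = 1)
    (V K L K' L' : Finset B) (hLK : L ⊆ K) (hK'L' : K' ⊆ L')
    (hpairK : (∑ b ∈ K, w b) * (∑ b ∈ K' ∩ V, w b) + (∑ b ∈ K', w b) * (∑ b ∈ K ∩ V, w b)
        - (∑ b ∈ V, w b) * (∑ b ∈ K, w b) * (∑ b ∈ K', w b) ≤ ∑ b ∈ (K ∩ K') ∩ V, R b)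
    (hpairL : (∑ b ∈ L, w b) * (∑ b ∈ L' ∩ V, w b) + (∑ b ∈ L', w b) * (∑ b ∈ L ∩ V, w b)
        - (∑ b ∈ V, w b) * (∑ b ∈ L, w b) * (∑ b ∈ L', w b) ≤ ∑ b ∈ (L ∩ L') ∩ V, R b)
    (hHarKK' : (∑ b ∈ K, w b) * (∑ b ∈ K' ∩ V, w b) ≤ ∑ b ∈ (K ∩ K') ∩ V, w b)
    (hHarL'L : (∑ b ∈ L', w b) * (∑ b ∈ L ∩ V, w b) ≤ ∑ b ∈ (L ∩ L') ∩ V, w b)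
    (hHar₄ : (∑ b ∈ K, w b) * (∑ b ∈ L', w b) ≤ ∑ b ∈ K ∩ L', w b)
    (hX : (∑ b ∈ (K \ L) ∩ V, w b) * (∑ b ∈ (L' \ K') ∩ V, w b) ≤ ∑ b ∈ ((K \ L) ∩ (L' \ K')) ∩ V, w b) :
    0 ≤ (∑ b ∈ (K ∩ L') ∩ V, w b) + (∑ b ∈ (L ∩ K') ∩ V, w b)
        - (∑ b ∈ K, w b) * (∑ b ∈ K' ∩ V, w b) - (∑ b ∈ L', w b) * (∑ b ∈ L ∩ V, w b)
        + (∑ b ∈ (K ∩ K') ∩ V, R b) + (∑ b ∈ (L ∩ L') ∩ V, R b)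
        - ((∑ b ∈ K, w b) * (∑ b ∈ L' ∩ V, w b) + (∑ b ∈ L', w b) * (∑ b ∈ K ∩ V, w b)
            - (∑ b ∈ V, w b) * (∑ b ∈ K, w b) * (∑ b ∈ L', w b))
        - ((∑ b ∈ L, w b) * (∑ b ∈ K' ∩ V, w b) + (∑ b ∈ K', w b) * (∑ b ∈ L ∩ V, w b)
            - (∑ b ∈ V, w b) * (∑ b ∈ L, w b) * (∑ b ∈ K', w b))
        + (1 - ∑ b ∈ V, w b) * (((∑ b ∈ K ∩ L', w b) - (∑ b ∈ K, w b) * (∑ b ∈ L', w b))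
            + ((∑ b ∈ K, w b) - ∑ b ∈ L, w b) * ((∑ b ∈ L', w b) - ∑ b ∈ K', w b)) := by
  -- names
  set v := ∑ b ∈ V, w b with hv
  set k := ∑ b ∈ K, w b with hk
  set l := ∑ b ∈ L, w b with hl
  set k' := ∑ b ∈ K', w b with hk'
  set l' := ∑ b ∈ L', w b with hl'
  set aK := ∑ b ∈ K ∩ V, w b with haK
  set aL := ∑ b ∈ L ∩ V, w b with haL
  set aK' := ∑ b ∈ K' ∩ V, w b with haK'
  set aL' := ∑ b ∈ L' ∩ V, w b with haL'
  set aKL' := ∑ b ∈ (K ∩ L') ∩ V, w b with haKL'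
  set aLK' := ∑ b ∈ (L ∩ K') ∩ V, w b with haLK'
  set aKK' := ∑ b ∈ (K ∩ K') ∩ V, w b with haKK'
  set aLL' := ∑ b ∈ (L ∩ L') ∩ V, w b with haLL'
  set mKL' := ∑ b ∈ K ∩ L', w b with hmKL'
  -- the two differences and the crossing cell in terms of the named masses
  have hA : ∑ b ∈ (K \ L) ∩ V, w b = aK - aL := sum_sdiff_inter w V K L hLK
  have hA' : ∑ b ∈ (L' \ K') ∩ V, w b = aL' - aK' := sum_sdiff_inter w V L' K' hK'L'
  have hΞ := sum_cross_cell w V K L K' L' hLK hK'L'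
  rw [hA, hA'] at hX
  rw [hΞ] at hX
  -- elementary bounds
  have hv1 : v ≤ 1 := by rw [hv, ← hw1]; exact sum_le_sum_of_subset' w hw (Finset.subset_univ V)
  have hlk : l ≤ k := sum_le_sum_of_subset' w hw hLK
  have hk'l' : k' ≤ l' := sum_le_sum_of_subset' w hw hK'L'
  -- c(A) = (k − l) − (aK − aL) ≥ 0 and c(A') = (l' − k') − (aL' − aK') ≥ 0
  have hcA : 0 ≤ (k - l) - (aK - aL) := by
    have h1 : ∑ b ∈ (K \ L) ∩ V, w b ≤ ∑ b ∈ K \ L, w b := sum_le_sum_of_subset' w hw Finset.inter_subset_left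
    have h2 : ∑ b ∈ K \ L, w b = k - l := Finset.sum_sdiff_eq_sub hLK
    linarith
  have hcA' : 0 ≤ (l' - k') - (aL' - aK') := by
    have h1 : ∑ b ∈ (L' \ K') ∩ V, w b ≤ ∑ b ∈ L' \ K', w b := sum_le_sum_of_subset' w hw Finset.inter_subset_left
    have h2 : ∑ b ∈ L' \ K', w b = l' - k' := Finset.sum_sdiff_eq_sub hK'L'
    linarith
  have hcc : 0 ≤ ((k - l) - (aK - aL)) * ((l' - k') - (aL' - aK')) := mul_nonneg hcA hcA'
  have hvC : 0 ≤ (1 - v) * (mKL' - k * l') := mul_nonneg (by linarith) (by linarith)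
  nlinarith [hpairK, hpairL, hHarKK', hHarL'L, hX, hcc, hvC]

/-- **Full-slot case (pure class).**  If the slot contains both larger sets, `K ∪ L' ⊆ V`, then with the same-footprint packing the
pure-class exchange expression equals `(2−v)·Har(K,L') + Har(L,K') + (pair slacks) ≥ 0` — whatever the crossing cell is.
Hypotheses: the pair inequalities at `(K,K')`, `(L,L')` and the Harris products `Har(K,L')`, `Har(L,K') ≥ 0`. [this work] -/
theorem exchange_pure_of_subset_slot [Fintype B] (w R : B → ℝ) (hw : ∀ b, 0 ≤ w b) (hw1 : ∑ b, w b = 1)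
    (V K L K' L' : Finset B) (hLK : L ⊆ K) (hK'L' : K' ⊆ L') (hKV : K ⊆ V) (hL'V : L' ⊆ V)
    (hpairK : (∑ b ∈ K, w b) * (∑ b ∈ K' ∩ V, w b) + (∑ b ∈ K', w b) * (∑ b ∈ K ∩ V, w b)
        - (∑ b ∈ V, w b) * (∑ b ∈ K, w b) * (∑ b ∈ K', w b) ≤ ∑ b ∈ (K ∩ K') ∩ V, R b)
    (hpairL : (∑ b ∈ L, w b) * (∑ b ∈ L' ∩ V, w b) + (∑ b ∈ L', w b) * (∑ b ∈ L ∩ V, w b)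
        - (∑ b ∈ V, w b) * (∑ b ∈ L, w b) * (∑ b ∈ L', w b) ≤ ∑ b ∈ (L ∩ L') ∩ V, R b)
    (hHar₄ : (∑ b ∈ K, w b) * (∑ b ∈ L', w b) ≤ ∑ b ∈ K ∩ L', w b)
    (hHarLK' : (∑ b ∈ L, w b) * (∑ b ∈ K', w b) ≤ ∑ b ∈ L ∩ K', w b) :
    0 ≤ (∑ b ∈ (K ∩ L') ∩ V, w b) + (∑ b ∈ (L ∩ K') ∩ V, w b)
        - (∑ b ∈ K, w b) * (∑ b ∈ K' ∩ V, w b) - (∑ b ∈ L', w b) * (∑ b ∈ L ∩ V, w b)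
        + (∑ b ∈ (K ∩ K') ∩ V, R b) + (∑ b ∈ (L ∩ L') ∩ V, R b)
        - ((∑ b ∈ K, w b) * (∑ b ∈ L' ∩ V, w b) + (∑ b ∈ L', w b) * (∑ b ∈ K ∩ V, w b)
            - (∑ b ∈ V, w b) * (∑ b ∈ K, w b) * (∑ b ∈ L', w b))
        - ((∑ b ∈ L, w b) * (∑ b ∈ K' ∩ V, w b) + (∑ b ∈ K', w b) * (∑ b ∈ L ∩ V, w b)
            - (∑ b ∈ V, w b) * (∑ b ∈ L, w b) * (∑ b ∈ K', w b))
        + (1 - ∑ b ∈ V, w b) * (((∑ b ∈ K ∩ L', w b) - (∑ b ∈ K, w b) * (∑ b ∈ L', w b))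
            + ((∑ b ∈ K, w b) - ∑ b ∈ L, w b) * ((∑ b ∈ L', w b) - ∑ b ∈ K', w b)) := by
  -- inside the slot every trace is the set itself
  have hLV : L ⊆ V := hLK.trans hKV
  have hK'V : K' ⊆ V := hK'L'.trans hL'V
  have eK : K ∩ V = K := Finset.inter_eq_left.2 hKV
  have eL : L ∩ V = L := Finset.inter_eq_left.2 hLV
  have eK' : K' ∩ V = K' := Finset.inter_eq_left.2 hK'V
  have eL' : L' ∩ V = L' := Finset.inter_eq_left.2 hL'V
  have eKL' : (K ∩ L') ∩ V = K ∩ L' := Finset.inter_eq_left.2 (Finset.inter_subset_left.trans hKV)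
  have eLK' : (L ∩ K') ∩ V = L ∩ K' := Finset.inter_eq_left.2 (Finset.inter_subset_left.trans hLV)
  have eKK' : (K ∩ K') ∩ V = K ∩ K' := Finset.inter_eq_left.2 (Finset.inter_subset_left.trans hKV)
  have eLL' : (L ∩ L') ∩ V = L ∩ L' := Finset.inter_eq_left.2 (Finset.inter_subset_left.trans hLV)
  simp only [eK, eL, eK', eL', eKL', eLK'] at hpairK hpairL ⊢
  set v := ∑ b ∈ V, w b with hv
  have hv1 : v ≤ 1 := by rw [hv, ← hw1]; exact sum_le_sum_of_subset' w hw (Finset.subset_univ V)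
  have hvC : 0 ≤ (1 - v) * ((∑ b ∈ K ∩ L', w b) - (∑ b ∈ K, w b) * (∑ b ∈ L', w b)) :=
    mul_nonneg (by linarith) (by linarith)
  nlinarith [hpairK, hpairL, hHar₄, hHarLK', hvC]

end Algebra

section Lattice

variable {α : Type*} [DistribLattice α] [Fintype α] [DecidableEq α]

/-- **Ahlswede–Daykin consequence.**  For `w ≥ 0` log-supermodular on a finite distributive lattice
(`w(x)·w(y) ≤ w(x ⊓ y)·w(x ⊔ y)`) and finsets `X, Y, J` with every join `x ⊔ y` (`x ∈ X`, `y ∈ Y`) in `J`: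
`w(X)·w(Y) ≤ w(J)·w(univ)`.  (Four functions theorem with `f₁ = f₂ = f₃ = f₄ = w`, then `X ⊼ Y ⊆ univ`, `X ⊻ Y ⊆ J`.)
[cite: AhlswedeDaykin1978, Thm 1] (Mathlib `four_functions_theorem`) -/
theorem sum_mul_sum_le_of_sups_subset (w : α → ℝ) (hw0 : ∀ a, 0 ≤ w a)
    (hw : ∀ a b, w a * w b ≤ w (a ⊓ b) * w (a ⊔ b)) (X Y J : Finset α) (hJ : X ⊻ Y ⊆ J) :
    (∑ a ∈ X, w a) * (∑ a ∈ Y, w a) ≤ (∑ a ∈ J, w a) * (∑ a, w a) := by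
  have h0 : (0 : α → ℝ) ≤ w := fun a => hw0 a
  have h4 := four_functions_theorem w w w w h0 h0 h0 h0 hw X Y
  have h1 : ∑ a ∈ X ⊼ Y, w a ≤ ∑ a, w a :=
    Finset.sum_le_sum_of_subset_of_nonneg (Finset.subset_univ _) fun a _ _ => hw0 a
  have h2 : ∑ a ∈ X ⊻ Y, w a ≤ ∑ a ∈ J, w a :=
    Finset.sum_le_sum_of_subset_of_nonneg hJ fun a _ _ => hw0 a
  have hJ0 : 0 ≤ ∑ a ∈ J, w a := Finset.sum_nonneg fun a _ => hw0 a
  have hI0 : 0 ≤ ∑ a ∈ X ⊼ Y, w a := Finset.sum_nonneg fun a _ => hw0 a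
  calc (∑ a ∈ X, w a) * (∑ a ∈ Y, w a) ≤ (∑ a ∈ X ⊼ Y, w a) * ∑ a ∈ X ⊻ Y, w a := h4
    _ ≤ (∑ a ∈ X ⊼ Y, w a) * ∑ a ∈ J, w a := mul_le_mul_of_nonneg_left h2 hI0
    _ ≤ (∑ a, w a) * ∑ a ∈ J, w a := mul_le_mul_of_nonneg_right h1 hJ0
    _ = (∑ a ∈ J, w a) * (∑ a, w a) := mul_comm _ _

/-- **Join case of the pure-class exchange lemma (order structure).**  `α` a finite distributive lattice, `w ≥ 0` log-supermodular
of mass `1` (an FKG weight), `L ⊆ K`, `K' ⊆ L'`, slot `V`; a weight `R` satisfying the pair inequality at `(K,K')`, `(L,L')`; the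
Harris products `Har(K;K'_V)`, `Har(L';L_V)`, `Har(K,L') ≥ 0`; and the JOIN CONDITION: every join `x ⊔ y` of a point
`x ∈ (K∖L)∩V` with a point `y ∈ (L'∖K')∩V` lies in the crossing cell `(K∖L)∩(L'∖K')∩V`.  Then the pure-class exchange expression
is `≥ 0` (Ahlswede–Daykin gives `a(K∖L)·a(L'∖K') ≤ w(Ξ)`, then `exchange_pure_of_cross_product_le`). [this work] -/
theorem exchange_pure_of_joins (w R : α → ℝ) (hw : ∀ b, 0 ≤ w b) (hw1 : ∑ b, w b = 1)
    (hfkg : ∀ a b, w a * w b ≤ w (a ⊓ b) * w (a ⊔ b))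
    (V K L K' L' : Finset α) (hLK : L ⊆ K) (hK'L' : K' ⊆ L')
    (hpairK : (∑ b ∈ K, w b) * (∑ b ∈ K' ∩ V, w b) + (∑ b ∈ K', w b) * (∑ b ∈ K ∩ V, w b)
        - (∑ b ∈ V, w b) * (∑ b ∈ K, w b) * (∑ b ∈ K', w b) ≤ ∑ b ∈ (K ∩ K') ∩ V, R b)
    (hpairL : (∑ b ∈ L, w b) * (∑ b ∈ L' ∩ V, w b) + (∑ b ∈ L', w b) * (∑ b ∈ L ∩ V, w b)
        - (∑ b ∈ V, w b) * (∑ b ∈ L, w b) * (∑ b ∈ L', w b) ≤ ∑ b ∈ (L ∩ L') ∩ V, R b)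
    (hHarKK' : (∑ b ∈ K, w b) * (∑ b ∈ K' ∩ V, w b) ≤ ∑ b ∈ (K ∩ K') ∩ V, w b)
    (hHarL'L : (∑ b ∈ L', w b) * (∑ b ∈ L ∩ V, w b) ≤ ∑ b ∈ (L ∩ L') ∩ V, w b)
    (hHar₄ : (∑ b ∈ K, w b) * (∑ b ∈ L', w b) ≤ ∑ b ∈ K ∩ L', w b)
    (hJ : ((K \ L) ∩ V) ⊻ ((L' \ K') ∩ V) ⊆ ((K \ L) ∩ (L' \ K')) ∩ V) :
    0 ≤ (∑ b ∈ (K ∩ L') ∩ V, w b) + (∑ b ∈ (L ∩ K') ∩ V, w b)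
        - (∑ b ∈ K, w b) * (∑ b ∈ K' ∩ V, w b) - (∑ b ∈ L', w b) * (∑ b ∈ L ∩ V, w b)
        + (∑ b ∈ (K ∩ K') ∩ V, R b) + (∑ b ∈ (L ∩ L') ∩ V, R b)
        - ((∑ b ∈ K, w b) * (∑ b ∈ L' ∩ V, w b) + (∑ b ∈ L', w b) * (∑ b ∈ K ∩ V, w b)
            - (∑ b ∈ V, w b) * (∑ b ∈ K, w b) * (∑ b ∈ L', w b))
        - ((∑ b ∈ L, w b) * (∑ b ∈ K' ∩ V, w b) + (∑ b ∈ K', w b) * (∑ b ∈ L ∩ V, w b)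
            - (∑ b ∈ V, w b) * (∑ b ∈ L, w b) * (∑ b ∈ K', w b))
        + (1 - ∑ b ∈ V, w b) * (((∑ b ∈ K ∩ L', w b) - (∑ b ∈ K, w b) * (∑ b ∈ L', w b))
            + ((∑ b ∈ K, w b) - ∑ b ∈ L, w b) * ((∑ b ∈ L', w b) - ∑ b ∈ K', w b)) := by
  have hX := sum_mul_sum_le_of_sups_subset w hw hfkg ((K \ L) ∩ V) ((L' \ K') ∩ V) (((K \ L) ∩ (L' \ K')) ∩ V) hJ
  rw [hw1, mul_one] at hX
  exact exchange_pure_of_cross_product_le w R hw hw1 V K L K' L' hLK hK'L' hpairK hpairL hHarKK' hHarL'L hHar₄ hX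

/-- **Top-crossing case of the pure-class exchange lemma.**  As in `exchange_pure_of_joins`, with the join condition derived from
the order structure: `K, L', V` are up-closed, `L, K'` are up-closed, and some point `ξ ∉ L ∪ K'` lies above every point of
`(K∖L)∩V` and of `(L'∖K')∩V` (for instance a crossing point dominating both slot-traces — then it is the unique maximal crossing
point).  Indeed a join `x ⊔ y` of such points lies in `K ∩ L' ∩ V` (up-closed sets) and below `ξ`, hence outside `L` and `K'`
(else `ξ ∈ L` resp. `ξ ∈ K'`), i.e. in the crossing cell. [this work] -/
theorem exchange_pure_of_topCross (w R : α → ℝ) (hw : ∀ b, 0 ≤ w b) (hw1 : ∑ b, w b = 1)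
    (hfkg : ∀ a b, w a * w b ≤ w (a ⊓ b) * w (a ⊔ b))
    (V K L K' L' : Finset α) (hLK : L ⊆ K) (hK'L' : K' ⊆ L')
    (hKup : ∀ ⦃x y : α⦄, x ∈ K → x ≤ y → y ∈ K) (hLup : ∀ ⦃x y : α⦄, x ∈ L → x ≤ y → y ∈ L)
    (hK'up : ∀ ⦃x y : α⦄, x ∈ K' → x ≤ y → y ∈ K') (hL'up : ∀ ⦃x y : α⦄, x ∈ L' → x ≤ y → y ∈ L')
    (hVup : ∀ ⦃x y : α⦄, x ∈ V → x ≤ y → y ∈ V)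
    (ξ : α) (hξL : ξ ∉ L) (hξK' : ξ ∉ K')
    (hA : ∀ x ∈ (K \ L) ∩ V, x ≤ ξ) (hA' : ∀ y ∈ (L' \ K') ∩ V, y ≤ ξ)
    (hpairK : (∑ b ∈ K, w b) * (∑ b ∈ K' ∩ V, w b) + (∑ b ∈ K', w b) * (∑ b ∈ K ∩ V, w b)
        - (∑ b ∈ V, w b) * (∑ b ∈ K, w b) * (∑ b ∈ K', w b) ≤ ∑ b ∈ (K ∩ K') ∩ V, R b)
    (hpairL : (∑ b ∈ L, w b) * (∑ b ∈ L' ∩ V, w b) + (∑ b ∈ L', w b) * (∑ b ∈ L ∩ V, w b)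
        - (∑ b ∈ V, w b) * (∑ b ∈ L, w b) * (∑ b ∈ L', w b) ≤ ∑ b ∈ (L ∩ L') ∩ V, R b)
    (hHarKK' : (∑ b ∈ K, w b) * (∑ b ∈ K' ∩ V, w b) ≤ ∑ b ∈ (K ∩ K') ∩ V, w b)
    (hHarL'L : (∑ b ∈ L', w b) * (∑ b ∈ L ∩ V, w b) ≤ ∑ b ∈ (L ∩ L') ∩ V, w b)
    (hHar₄ : (∑ b ∈ K, w b) * (∑ b ∈ L', w b) ≤ ∑ b ∈ K ∩ L', w b) :
    0 ≤ (∑ b ∈ (K ∩ L') ∩ V, w b) + (∑ b ∈ (L ∩ K') ∩ V, w b)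
        - (∑ b ∈ K, w b) * (∑ b ∈ K' ∩ V, w b) - (∑ b ∈ L', w b) * (∑ b ∈ L ∩ V, w b)
        + (∑ b ∈ (K ∩ K') ∩ V, R b) + (∑ b ∈ (L ∩ L') ∩ V, R b)
        - ((∑ b ∈ K, w b) * (∑ b ∈ L' ∩ V, w b) + (∑ b ∈ L', w b) * (∑ b ∈ K ∩ V, w b)
            - (∑ b ∈ V, w b) * (∑ b ∈ K, w b) * (∑ b ∈ L', w b))
        - ((∑ b ∈ L, w b) * (∑ b ∈ K' ∩ V, w b) + (∑ b ∈ K', w b) * (∑ b ∈ L ∩ V, w b)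
            - (∑ b ∈ V, w b) * (∑ b ∈ L, w b) * (∑ b ∈ K', w b))
        + (1 - ∑ b ∈ V, w b) * (((∑ b ∈ K ∩ L', w b) - (∑ b ∈ K, w b) * (∑ b ∈ L', w b))
            + ((∑ b ∈ K, w b) - ∑ b ∈ L, w b) * ((∑ b ∈ L', w b) - ∑ b ∈ K', w b)) := by
  refine exchange_pure_of_joins w R hw hw1 hfkg V K L K' L' hLK hK'L' hpairK hpairL hHarKK' hHarL'L hHar₄ ?_
  intro z hz
  rw [Finset.mem_sups] at hz
  obtain ⟨x, hx, y, hy, rfl⟩ := hz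
  have hxξ := hA x hx
  have hyξ := hA' y hy
  simp only [Finset.mem_inter, Finset.mem_sdiff] at hx hy ⊢
  obtain ⟨⟨hxK, hxL⟩, hxV⟩ := hx
  obtain ⟨⟨hyL', hyK'⟩, hyV⟩ := hy
  refine ⟨⟨⟨hKup hxK le_sup_left, fun h => hξL (hLup h (sup_le hxξ hyξ))⟩,
    ⟨hL'up hyL' le_sup_right, fun h => hξK' (hK'up h (sup_le hxξ hyξ))⟩⟩, hVup hxV le_sup_left⟩

end Lattice

end Summit.CriticalPhenomena.PercolationContinuityZ3.Theorems.SahiE3ExchangeJoin
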